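/-
Copyright: b2b-lace packet (literature seat, gen 12).  The ONE-STEP LIFT of the two-point function,
`τ_p(x) ≤ 2dp (D ⋆ τ_p)(x)` for `x ≠ 0` ([FvdH17] (4.3) at `m = 1`), and its RESIDUE for the bubble:
`(τ_p ⋆ τ_p)(c) ≤ 2dp (D ⋆ τ_p ⋆ τ_p)(c) + τ_p(c)(1 − 2dp·τ_p(e₁))` for `c ≠ 0` — the kernel form of the
observation (packet DIVERGENCE D57 addendum 1 (ii); boundary referee R250) that the lattice-parity lift of a
TWO-`G` tail in [NoBLE17-I] (5.41)/(5.42) leaves a one-`G` residue.  Over the tree objects `tau`, `tauGe`,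
`srwStep`, `latticeConv`; no cited fact, no named hypothesis (finite susceptibility enters as the binder
`Summable (tau d p 0)`).
-/
import Literature.Probability.FitznerVanDerHofstad2017.TwoPointSrwBound
import HarnessLib

/-!
# The one-step lift `τ_p ≤ 2dp D ⋆ τ_p` off the origin, and the residue it leaves on a bubble

[FvdH17] (4.3) (arXiv:1506.07977v2 p. 34 = EJP 22 (2017) no. 43 p. 32) reads
`τ_{m,p}(x) ≤ (2dp)^m (D^{⋆m} ⋆ τ_p)(x)`; at `m = 1` and `x ≠ 0` one has `τ_{1,p}(x) = τ_p(x)` (a connection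
between distinct sites uses at least one bond), whence the **one-step lift**

* `tau_le_lift` : `τ_p(x) ≤ 2dp (D ⋆ τ_p)(x)` for `x ≠ 0`

(the tree's `tauGe_le_pow_mul_srwConv_tau` of `TwoPointSrwBound` specialised).  On `ℤ^d`, which is bipartite
(`Percolation/LatticeWordParity`), this is the device by which a remainder of the "wrong" parity is one step
longer for free — for a SINGLE two-point factor.  For a product of two factors the same device applied to
one factor leaves the diagonal term behind:

* `bubble_le_lift_add_residue` : for `c ≠ 0` and `Σ_x τ_p(x) < ∞`,
  `(τ_p ⋆ τ_p)(c) ≤ 2dp (D ⋆ (τ_p ⋆ τ_p))(c) + τ_p(c) · (1 − 2dp·τ_p(e₁))`,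

proved exactly as on paper: split `(τ⋆τ)(c) = Σ_y τ(y)τ(c−y)` at `y = c` (term `τ(c)τ(0) = τ(c)`), lift
every other term (`c − y ≠ 0`), and re-assemble `Σ_y τ(y)(D⋆τ)(c−y) = (D ⋆ τ ⋆ τ)(c) − … ` — in the tree:
`Σ_{y} τ(y)·2dp(D⋆τ)(c−y) = 2dp (τ ⋆ (D⋆τ))(c) = 2dp (D ⋆ (τ⋆τ))(c)` (commutativity and the `ℓ¹ × ℓ¹ × ℓ^∞`
associativity `latticeConv_assoc_of_bdd`), the subtracted diagonal lift being `2dp·τ(c)·(D⋆τ)(0)` with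
`(D ⋆ τ_p)(0) = τ_p(e₁)` (`srwConv_tau_zero`, signed-permutation symmetry `tauGe_stepVec`; `τ_p(−x) = τ_p(x)` is the tree's `Percolation.tau_zero_neg`, here obtained from `tau_eq_tau_zero_sub` + `tau_comm` to keep the imports minimal).  The residue
`τ_p(c)(1 − 2dp τ_p(e₁))` is not removable: at `c = e₁` the left side is `2p + O(p³)` while
`2dp (D⋆τ⋆τ)(e₁) = p + O(p³)` (R250), so the naked lift `(τ⋆τ)(c) ≤ 2dp(D⋆τ⋆τ)(c)` is false in general.
This is the reason the parity-lifted extraction scheme certifies the one-`G` multiplicity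
`C(R−m,2) + (R−1−m) + 1 = C(R+1−m,2)` of [NoBLE17-I] (5.41) (the derivable count) and not the printed
closed form `C(R−m,2)` (packet DIVERGENCE D27 (a)(b) / D57; `RepulsiveTriangleExtraction.card_triPairsO`).

## References
* [FvdH17] R. Fitzner, R. van der Hofstad, Mean-field behavior for nearest-neighbor percolation in `d > 10`,
  Electron. J. Probab. 22 (2017) no. 43; arXiv:1506.07977v2 — §4.2 (4.1), (4.3).
* [NoBLE17] R. Fitzner, R. van der Hofstad, Generalized approach to the non-backtracking lace expansion,
  Probab. Theory Relat. Fields 169 (2017) 1041–1119 — §5.3.2 (5.40)–(5.42) (the `G`-tails and their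
  multiplicities).
-/

noncomputable section

namespace Literature.Probability.FitznerVanDerHofstad2017

open Literature.Probability.Percolation
open Literature.Probability.LatticeModels
open Literature.Barriers.CriticalPhenomena
open Literature.Barriers.CriticalPhenomena.SpreadOutIsing (latticeConv convPow latticeConv_comm
  latticeConv_assoc_of_bdd convPow_one_eq)
open scoped BigOperators

variable {d : ℕ}

/-! ### The one-step lift -/

/-- `τ_{1,p}(x) = τ_p(x)` for `x ≠ 0`: a connection between distinct sites has length `≥ 1`
(PATH READING of `τ_{m,p}`). [cite: FitznerVanDerHofstad2017, §4.2 (4.1) arXiv:1506.07977v2 p. 34 = EJP p. 31] -/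
theorem tauGe_one_eq_tau (p : unitInterval) {x : Site d} (hx : x ≠ 0) : tauGe d p 1 x = tau d p 0 x := by
  rw [tauGe, tau_def, openConnGe_one_eq hx.symm]

/-- `τ_p(e_ι) = τ_p(e₁)` for each of the `2d` unit steps (signed-permutation symmetry; the unit step
is nonzero, cf. `DoubleConnectionBubble.stepVec_ne_zero_site`).
[cite: FitznerVanDerHofstad2017, §4.2 (4.1) arXiv:1506.07977v2 p. 34 = EJP p. 31] -/
theorem tau_stepVec (hd : 1 ≤ d) (p : unitInterval) (ι : Fin d × Bool) :
    tau d p 0 (stepVec ι) = tau d p 0 (unitSite1 d) := by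
  have hι : stepVec ι ≠ (0 : Site d) := by
    intro h
    have h1 := congrFun h ι.1
    obtain ⟨i, b⟩ := ι
    cases b <;> simp [stepVec] at h1
  rw [← tauGe_one_eq_tau p hι, tauGe_stepVec hd, tauGe_one_eq_tau p (unitSite1_ne_zero hd)]

/-- **The one-step lift**: `τ_p(x) ≤ 2dp · (D ⋆ τ_p)(x)` for `x ≠ 0` — [FvdH17] (4.3) at `m = 1`.
[cite: FitznerVanDerHofstad2017, §4.2 (4.3) arXiv:1506.07977v2 p. 34 = EJP p. 32] -/
theorem tau_le_lift (p : unitInterval) {x : Site d} (hx : x ≠ 0) :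
    tau d p 0 x ≤ 2 * d * (p : ℝ) * latticeConv (srwStep d) (tau d p 0) x := by
  have h := tauGe_le_pow_mul_srwConv_tau p 1 x
  rwa [tauGe_one_eq_tau p hx, pow_one, convPow_one_eq] at h

/-- **`(D ⋆ τ_p)(0) = τ_p(e₁)`**: the average of `τ_p` over the `2d` neighbours of the origin.
[cite: FitznerVanDerHofstad2017, §4.2 (4.3) arXiv:1506.07977v2 p. 34 = EJP p. 32] -/
theorem srwConv_tau_zero (hd : 1 ≤ d) (p : unitInterval) :
    latticeConv (srwStep d) (tau d p 0) 0 = tau d p 0 (unitSite1 d) := by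
  have h := sum_words_eq_pow_mul_latticeConv 1 (tau d p 0) (0 : Site d)
  rw [pow_one, convPow_one_eq] at h
  have hterm : ∀ w : Fin 1 → Fin d × Bool, tau d p 0 (0 - wordPos w 1) = tau d p 0 (unitSite1 d) := by
    intro w
    rw [← tau_eq_tau_zero_sub, tau_comm, wordPos_succ w (k := 0) Nat.one_pos, wordPos_zero, zero_add, tau_stepVec hd]
  rw [Finset.sum_congr rfl fun w _ => hterm w, Finset.sum_const, Finset.card_univ, nsmul_eq_mul] at h
  have hcard : (Fintype.card (Fin 1 → Fin d × Bool) : ℝ) = 2 * d := by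
    rw [Fintype.card_fun, Fintype.card_fin, Fintype.card_prod, Fintype.card_fin, Fintype.card_bool, pow_one]
    push_cast
    ring
  rw [hcard] at h
  have h2d : (2 * d : ℝ) ≠ 0 := by
    have : (1 : ℝ) ≤ d := by exact_mod_cast hd
    positivity
  exact (mul_left_cancel₀ h2d h).symm

/-! ### The residue on a bubble -/

/-- **Lifting ONE factor of a bubble leaves the diagonal term** (boundary referee R250's form of packet
DIVERGENCE D57 addendum 1 (ii)): for `c ≠ 0` and finite susceptibility `Σ_x τ_p(x) < ∞`,
`(τ_p ⋆ τ_p)(c) ≤ 2dp · (D ⋆ (τ_p ⋆ τ_p))(c) + τ_p(c) · (1 − 2dp · τ_p(e₁))`.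
The last term is the one-`G` residue that makes the naked lift `(τ⋆τ)(c) ≤ 2dp (D⋆τ⋆τ)(c)` false in general.
[cite: FitznerVanDerHofstad2017, §4.2 (4.3) arXiv:1506.07977v2 p. 34 = EJP p. 32]
[cite: FitznerVanDerHofstad2016NoBLE, §5.3.2 (5.40)–(5.41) PTRF p. 1098] -/
theorem bubble_le_lift_add_residue (hd : 1 ≤ d) (p : unitInterval) (hs : Summable (tau d p 0))
    {c : Site d} (hc : c ≠ 0) :
    latticeConv (tau d p 0) (tau d p 0) c ≤
      2 * d * (p : ℝ) * latticeConv (srwStep d) (latticeConv (tau d p 0) (tau d p 0)) c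
        + tau d p 0 c * (1 - 2 * d * (p : ℝ) * tau d p 0 (unitSite1 d)) := by
  set τ : Site d → ℝ := tau d p 0 with hτ
  set K : ℝ := 2 * d * (p : ℝ) with hK
  have hτ0 : ∀ x, 0 ≤ τ x := fun x => tau_nonneg p 0 x
  have hD0 : ∀ x, 0 ≤ srwStep d x := fun x => srwStep_nonneg x
  set Dτ : Site d → ℝ := latticeConv (srwStep d) τ with hDτ
  have hDτ0 : ∀ x, 0 ≤ Dτ x := fun x => latticeConv_nonneg hD0 hτ0 x
  have hsDτ : Summable Dτ := summable_latticeConv summable_srwStep hs hD0 hτ0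
  -- the majorant: lifted off-diagonal terms `F` plus the diagonal residue `R`
  set F : Site d → ℝ := fun y => K * (τ y * Dτ (c - y)) with hF
  set R : Site d → ℝ := fun y => if y = c then τ c * (1 - K * τ (unitSite1 d)) else 0 with hR
  have hpt : ∀ y, τ y * τ (c - y) ≤ F y + R y := by
    intro y
    by_cases hy : y = c
    · subst hy
      have h0 : Dτ 0 = τ (unitSite1 d) := srwConv_tau_zero hd p
      simp only [hF, hR, if_true, sub_self, h0]
      have h1 : τ 0 = 1 := tau_self p 0
      rw [h1]
      nlinarith [hτ0 y]
    · have hne : c - y ≠ 0 := sub_ne_zero.mpr (Ne.symm hy)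
      have hl : τ (c - y) ≤ K * Dτ (c - y) := tau_le_lift p hne
      simp only [hF, hR, hy, if_false, add_zero]
      calc τ y * τ (c - y) ≤ τ y * (K * Dτ (c - y)) := mul_le_mul_of_nonneg_left hl (hτ0 y)
        _ = K * (τ y * Dτ (c - y)) := by ring
  have hsL : Summable fun y => τ y * τ (c - y) := summable_latticeConv_inner hs hs hτ0 hτ0 c
  have hsF : Summable F := (summable_latticeConv_inner hs hsDτ hτ0 hDτ0 c).mul_left K
  have hsR : Summable R := (hasSum_ite_eq c (τ c * (1 - K * τ (unitSite1 d)))).summable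
  -- associativity inputs: `D, τ ∈ ℓ¹`, `τ ≤ 1`
  have haD : Summable fun x => |srwStep d x| := summable_srwStep.congr fun x => (abs_of_nonneg (hD0 x)).symm
  have haτ : Summable fun x => |τ x| := hs.congr fun x => (abs_of_nonneg (hτ0 x)).symm
  have hbτ : ∀ x, |τ x| ≤ 1 := fun x => by rw [abs_of_nonneg (hτ0 x)]; exact tau_le_one p 0 x
  have hFsum : ∑' y, F y = K * latticeConv (srwStep d) (latticeConv τ τ) c := by
    rw [hF, tsum_mul_left]
    congr 1
    change latticeConv τ Dτ c = _
    rw [latticeConv_comm, hDτ, latticeConv_assoc_of_bdd haD haτ hbτ]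
  have hRsum : ∑' y, R y = τ c * (1 - K * τ (unitSite1 d)) := (hasSum_ite_eq c _).tsum_eq
  calc latticeConv τ τ c = ∑' y, τ y * τ (c - y) := rfl
    _ ≤ ∑' y, (F y + R y) := hsL.tsum_le_tsum hpt (hsF.add hsR)
    _ = ∑' y, F y + ∑' y, R y := hsF.tsum_add hsR
    _ = K * latticeConv (srwStep d) (latticeConv τ τ) c + τ c * (1 - K * τ (unitSite1 d)) := by
        rw [hFsum, hRsum]

end Literature.Probability.FitznerVanDerHofstad2017

end
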